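import Summits.CriticalPhenomena.PercolationContinuityZ3.Theorems.PercNearOneGluingNoHeavyLowerTailCubicThreePointApexCasesA
import Mathlib.Tactic.Linarith
import Mathlib.Tactic.Ring
import HarnessLib

/-!
# `NoHeavyLowerTail` (stmt-CriticalPhenomena-4575) — THEOREM `Γ₁ = AG − u₃·n′ ≥ 0` on every finite weighted graph (unconditional)

Support file (prover prim-ineq-gen-2 gen 3, new-inequality factory; `--supports stmt-CriticalPhenomena-4575`), continuing
`…CubicThreePointApexInduction` / `…ApexCasesA`.  No named facts, no sorries.

WHAT.  For bond percolation on an arbitrary finite weighted graph (random edges `D` with weights `p ∈ [0,1]`, forced edges `K`) and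
terminals `a, b, c` with cells `q = P(a|b|c), u₁ = P(ab|c), u₂ = P(ac|b), u₃ = P(bc|a), t = P(abc)` and the apex-refined cell
`n′ = P(a|b|c ∧ V(C_a) separates b from c in the support D ∪ K)` (`evNp`):

  `gammaOne_nonneg`:   `u₃ · n′ ≤ AG := q·t − (u₁u₂ + u₁u₃ + u₂u₃)`,   i.e.  `Γ₁ := AG − u₃·n′ ≥ 0`.

This sharpens Gladkov's `AG ≥ 0` [Gladkov 2024, Thm 2.1] by the exact star defect (`Γ₁ = 0` on every hub gluing, where `u₃n′ = AG`),
and is the half of the census-validated row `Γ = AG − u₃(n + n′)` (`…ApexInduction.gamma_of_stepHypB`, conditional on LEMMA B) that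
needs no correlation inequality at all.
HOW.  Gladkov's one-coordinate concavity, restricted to the edges at the terminal `b` (strong induction on `|D|`, peeling a random edge
`e = {x,m}` with `x` forced-joined to `b`, exactly as in `…ApexInduction`): along such an edge the six masses `(q, n′, u₁, u₂, u₃, t)` move by
the five coarse transition masses of `…CubicThreePointTransitions` (read with the terminals `a ↔ b` exchanged: `s₁ : a|b|c → ab|c`,
`s₃ : a|b|c → bc|a`, `rᵢ : petal i → abc`) and by `β : N′ → ab|c` with `0 ≤ β ≤ s₁` (`trans_Np`: a separating configuration can only
leave `a|b|c` towards `ab|c` — leaving towards `bc|a` would exhibit a `b–c` support path avoiding `C_a` — and inside `a|b|c` the cluster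
of `a`, hence separation, is unchanged), and the chord coefficient is
`s₁r₁ + s₃r₃ + r₁r₂ + r₁r₃ + r₂r₃ + s₃(s₁ − β) + r₃β ≥ 0` (`Gam1R_transition`); the closed section has the larger support (`n′` smaller,
`Γ₁` larger), the forced section is the minor with `e` forced; with `b` frozen `Γ₁ = 0`.
Memo: run/shared/lean/prim/prim-ineq-gen-2/HMAX-SPLIT.md §15.  [cite: Gladkov2024StrongFKG, Thm. 2.1 and its proof (coordinate concavity of AG)]
-/

noncomputable section

namespace Summit.CriticalPhenomena.PercolationContinuityZ3.Theorems

namespace CubicThreePointApex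

open Finset SimpleGraph Literature.Probability.Percolation.DecisionTree CubicThreePointStep CubicThreePointTerminal

variable {V : Type*} [DecidableEq V]

/-! ### Algebra: `Γ₁` in the six cells and its chord along a terminal edge -/

section Algebra

variable {R : Type*} [CommRing R]

/-- `Γ₁ = q·t − u₁u₂ − u₃(u₁ + u₂ + n′)` in the cells `(q, n′, u₁, u₂, u₃, t)`. [folklore] -/
def Gam1R (Q N' U₁ U₂ U₃ T : R) : R := Q * T - U₁ * U₂ - U₃ * (U₁ + U₂ + N')

/-- `Γ₁ = AG − u₃·n′`. [folklore] -/
theorem Gam1R_eq_AG (Q N' U₁ U₂ U₃ T : R) : Gam1R Q N' U₁ U₂ U₃ T = AG Q U₁ U₂ U₃ T - U₃ * N' := by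
  simp only [Gam1R, AG]; ring

/-- **The chord of `Γ₁` along an edge at `b`, in transition masses.**  If the forced section is the closed section moved by
`q ↦ q − s₁ − s₃`, `n′ ↦ n′ − β`, `u₁ ↦ u₁ + s₁ − r₁`, `u₂ ↦ u₂ − r₂`, `u₃ ↦ u₃ + s₃ − r₃`, `t ↦ t + r₁ + r₂ + r₃`, then along the segment
`Γ₁(x_p) = (1−p)Γ₁(x⁰) + pΓ₁(x¹) + p(1−p)·[s₁r₁ + s₃r₃ + r₁r₂ + r₁r₃ + r₂r₃ + s₃(s₁ − β) + r₃β]`. [folklore] -/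
theorem Gam1R_transition (p Q N' U₁ U₂ U₃ T s₁ s₃ r₁ r₂ r₃ β : R) :
    Gam1R (Q - p * (s₁ + s₃)) (N' - p * β) (U₁ + p * (s₁ - r₁)) (U₂ - p * r₂) (U₃ + p * (s₃ - r₃))
        (T + p * (r₁ + r₂ + r₃)) =
      (1 - p) * Gam1R Q N' U₁ U₂ U₃ T +
        p * Gam1R (Q - (s₁ + s₃)) (N' - β) (U₁ + (s₁ - r₁)) (U₂ - r₂) (U₃ + (s₃ - r₃)) (T + (r₁ + r₂ + r₃)) +
        p * (1 - p) * (s₁ * r₁ + s₃ * r₃ + r₁ * r₂ + r₁ * r₃ + r₂ * r₃ + s₃ * (s₁ - β) + r₃ * β) := by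
  simp only [Gam1R]; ring

/-- **The one-edge step for `Γ₁` in transition form**: nonnegative transition masses with `β ≤ s₁` and `Γ₁ ≥ 0` at both sections give
`Γ₁ ≥ 0` on the segment. [folklore] -/
theorem Gam1R_step {p Q₀ N₀ A₀ B₀ C₀ T₀ Q₁ N₁ A₁ B₁ C₁ T₁ s₁ s₃ r₁ r₂ r₃ β : ℝ} (hp₀ : 0 ≤ p) (hp₁ : p ≤ 1)
    (hQ : Q₀ = Q₁ + s₁ + s₃) (hA : A₁ + r₁ = A₀ + s₁) (hB : B₁ + r₂ = B₀) (hC : C₁ + r₃ = C₀ + s₃)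
    (hT : T₁ = T₀ + r₁ + r₃ + r₂) (hN : N₀ = N₁ + β)
    (hs₁ : 0 ≤ s₁) (hs₃ : 0 ≤ s₃) (hr₁ : 0 ≤ r₁) (hr₂ : 0 ≤ r₂) (hr₃ : 0 ≤ r₃) (hβ₀ : 0 ≤ β) (hβ₁ : β ≤ s₁)
    (h₀ : 0 ≤ Gam1R Q₀ N₀ A₀ B₀ C₀ T₀) (h₁ : 0 ≤ Gam1R Q₁ N₁ A₁ B₁ C₁ T₁) :
    0 ≤ Gam1R ((1 - p) * Q₀ + p * Q₁) ((1 - p) * N₀ + p * N₁) ((1 - p) * A₀ + p * A₁) ((1 - p) * B₀ + p * B₁)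
        ((1 - p) * C₀ + p * C₁) ((1 - p) * T₀ + p * T₁) := by
  have hQ1 : Q₁ = Q₀ - (s₁ + s₃) := by linarith
  have hA1 : A₁ = A₀ + (s₁ - r₁) := by linarith
  have hB1 : B₁ = B₀ - r₂ := by linarith
  have hC1 : C₁ = C₀ + (s₃ - r₃) := by linarith
  have hT1 : T₁ = T₀ + (r₁ + r₂ + r₃) := by linarith
  have hN1 : N₁ = N₀ - β := by linarith
  subst hQ1 hA1 hB1 hC1 hT1 hN1
  have e1 : (1 - p) * Q₀ + p * (Q₀ - (s₁ + s₃)) = Q₀ - p * (s₁ + s₃) := by ring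
  have e2 : (1 - p) * N₀ + p * (N₀ - β) = N₀ - p * β := by ring
  have e3 : (1 - p) * A₀ + p * (A₀ + (s₁ - r₁)) = A₀ + p * (s₁ - r₁) := by ring
  have e4 : (1 - p) * B₀ + p * (B₀ - r₂) = B₀ - p * r₂ := by ring
  have e5 : (1 - p) * C₀ + p * (C₀ + (s₃ - r₃)) = C₀ + p * (s₃ - r₃) := by ring
  have e6 : (1 - p) * T₀ + p * (T₀ + (r₁ + r₂ + r₃)) = T₀ + p * (r₁ + r₂ + r₃) := by ring
  rw [e1, e2, e3, e4, e5, e6, Gam1R_transition]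
  have hq : 0 ≤ 1 - p := by linarith
  have hG : 0 ≤ s₁ * r₁ + s₃ * r₃ + r₁ * r₂ + r₁ * r₃ + r₂ * r₃ + s₃ * (s₁ - β) + r₃ * β := by
    have h1 := mul_nonneg hs₁ hr₁
    have h2 := mul_nonneg hs₃ hr₃
    have h3 := mul_nonneg hr₁ hr₂
    have h4 := mul_nonneg hr₁ hr₃
    have h5 := mul_nonneg hr₂ hr₃
    have h6 := mul_nonneg hs₃ (sub_nonneg.2 hβ₁)
    have h7 := mul_nonneg hr₃ hβ₀
    linarith
  have k1 := mul_nonneg hq h₀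
  have k2 := mul_nonneg hp₀ h₁
  have k3 := mul_nonneg (mul_nonneg hp₀ hq) hG
  linarith

end Algebra

/-! ### The `N′`-transition along an edge at `b`'s forced cluster -/

/-- Separation only sees the cluster of `a`: equal clusters give equal separation. [folklore] -/
theorem Sep_congr {E K K' S : Finset (Sym2 V)} {a b c : V} (hC : ∀ z, R K' S a z ↔ R K S a z) :
    Sep E K' S a b c ↔ Sep E K S a b c := by
  unfold Sep
  simp only [hC]

section TransNp

variable {K : Finset (Sym2 V)} {a b c x m : V} (hbx : ∀ S : Finset (Sym2 V), R K S b x)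
include hbx

/-- Inside `a|b|c` the edge `{x,m}` (`x` joined to `b`) does not change the cluster of `a`. [folklore] -/
theorem cluster_a_of_evQ {S : Finset (Sym2 V)} (hq : S ∈ evQ (insert s(x, m) K) a b c) (z : V) :
    R (insert s(x, m) K) S a z ↔ R K S a z := by
  refine ⟨fun h => ?_, fun h => R_mono_insert _ h⟩
  rcases reach_insert_cases h with h' | ⟨h1, _⟩ | ⟨h1, h2⟩
  · exact h'
  · exact absurd (R_mono_insert s(x, m) (h1.trans (hbx S).symm)) hq.1
  · -- `a ~ m` and `x ~ z`: then `a ~ b` once the edge is forced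
    have hxm : x ≠ m := fun hxm0 => hq.1 (R_mono_insert _ ((hxm0 ▸ h1).trans (hbx S).symm))
    have : R (insert s(x, m) K) S a b :=
      ((R_mono_insert s(x, m) h1).trans (R_insert_edge hxm).symm).trans (R_mono_insert _ (hbx S).symm)
    exact absurd this hq.1

/-- **`N′`-transition.**  Along an edge `{x,m}` at `b`'s forced cluster, inside a support `E` containing all open and forced edges,
`N′(K) = N′(K ∪ {e}) + β` with `β` the mass of separating configurations in which the edge joins `b` to `a`
(no separating configuration moves to `bc|a`; the others keep their `a`-cluster, hence stay separating). [folklore] -/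
theorem trans_Np {E : Finset (Sym2 V)} (D : Finset (Sym2 V)) (p : Sym2 V → ℝ)
    (hE : ∀ S, S ⊆ D → ∀ f, f ∈ S ∪ insert s(x, m) K → f ∈ E) :
    PrW D p (evNp E K a b c) = PrW D p (evNp E (insert s(x, m) K) a b c) +
      PrW D p (evNp E K a b c ∩ evU₁ (insert s(x, m) K) a b c) := by
  refine PrW_of_ind_add D p fun S hS => ?_
  set K' := insert s(x, m) K with hK'
  by_cases h : S ∈ evNp E K a b c
  · rw [ind_of_mem h]
    obtain ⟨⟨hab0, hac0, hbc0⟩, hsep⟩ := h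
    by_cases hab1 : R K' S a b
    · -- the edge joins `b` to `a`: the configuration moves to `ab|c`
      have hac1 : ¬ R K' S a c := by
        intro hac1
        exact hac0 (gain_both (hbx S) hab1.symm (fun h' => hab0 h'.symm) (hab1.symm.trans hac1) hbc0)
      rw [ind_of_not_mem (fun h' : S ∈ evNp E K' a b c => h'.1.1 hab1),
        ind_of_mem (show S ∈ evNp E K a b c ∩ evU₁ K' a b c from ⟨⟨⟨hab0, hac0, hbc0⟩, hsep⟩, hab1, hac1⟩)]
      ring
    · -- otherwise it stays in `a|b|c` (it cannot reach `bc|a`: that would refute separation) and stays separating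
      have hac1 : ¬ R K' S a c := by
        intro hac1
        rcases reach_insert_cases hac1 with h' | ⟨h1, _⟩ | ⟨_, h2⟩
        · exact hac0 h'
        · exact hab0 (h1.trans (hbx S).symm)
        · exact hbc0 ((hbx S).trans h2)
      have hbc1 : ¬ R K' S b c := by
        intro hbc1
        rcases reach_insert_cases hbc1 with h' | ⟨_, h2⟩ | ⟨_, h2⟩
        · exact hbc0 h'
        · -- `m ~ c`: the open-or-forced `b–c` path avoids `C_a` inside the support
          refine not_Sep_of_reach (K := K) (K' := K') hbc1 (hE S hS) (fun z hz haz => ?_) hsep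
          rcases reach_insert_cases hz with h'' | ⟨_, h3⟩ | ⟨_, h3⟩
          · exact hab0 (haz.trans h''.symm)
          · exact hac0 ((haz.trans h3.symm).trans h2)
          · exact hab0 ((haz.trans h3.symm).trans (hbx S).symm)
        · exact hbc0 ((hbx S).trans h2)
      have hq1 : S ∈ evQ K' a b c := ⟨hab1, hac1, hbc1⟩
      have hsep1 : Sep E K' S a b c := (Sep_congr (cluster_a_of_evQ hbx hq1)).2 hsep
      rw [ind_of_mem (show S ∈ evNp E K' a b c from ⟨⟨hab1, hac1, hbc1⟩, hsep1⟩),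
        ind_of_not_mem (fun h' : S ∈ evNp E K a b c ∩ evU₁ K' a b c => hab1 h'.2.1)]
      ring
  · rw [ind_of_not_mem h, ind_of_not_mem (fun h' : S ∈ evNp E K a b c ∩ evU₁ K' a b c => h h'.1)]
    have : S ∉ evNp E K' a b c := by
      intro h'
      have hq1 : S ∈ evQ K' a b c := h'.1
      refine h ⟨⟨fun h'' => hq1.1 (R_mono_insert _ h''), fun h'' => hq1.2.1 (R_mono_insert _ h''),
        fun h'' => hq1.2.2 (R_mono_insert _ h'')⟩, ?_⟩
      exact (Sep_congr (cluster_a_of_evQ hbx hq1)).1 h'.2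
    rw [ind_of_not_mem this]; ring

end TransNp

/-! ### `Γ₁` on the weighted law -/

/-- `Γ₁` on the weighted three-point law (random edges `D`, weights `p`, forced edges `K`, apex `a`), the separating cell `N′` taken with
respect to the support `E`. [folklore] -/
def Gam1W (E D : Finset (Sym2 V)) (p : Sym2 V → ℝ) (K : Finset (Sym2 V)) (a b c : V) : ℝ :=
  Gam1R (PrW D p (evQ K a b c)) (PrW D p (evNp E K a b c)) (PrW D p (evU₁ K a b c)) (PrW D p (evU₂ K a b c))
    (PrW D p (evU₃ K a b c)) (PrW D p (evT K a b c))

/-- Enlarging the support can only increase `Γ₁` (it lowers `n′`, whose coefficient is `−u₃ ≤ 0`). [folklore] -/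
theorem Gam1W_mono_support (D : Finset (Sym2 V)) {p : Sym2 V → ℝ} (hp0 : ∀ i, 0 ≤ p i) (hp1 : ∀ i, p i ≤ 1)
    {E E' : Finset (Sym2 V)} (hE : E ⊆ E') (K : Finset (Sym2 V)) (a b c : V) :
    Gam1W E D p K a b c ≤ Gam1W E' D p K a b c := by
  unfold Gam1W Gam1R
  have h1 := PrW_evNp_anti D hp0 hp1 hE K a b c
  have h2 : 0 ≤ PrW D p (evU₃ K a b c) := PrW_nonneg D hp0 hp1 _
  nlinarith [mul_le_mul_of_nonneg_left h1 h2]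

/-- If no non-loop random edge touches the forced cluster of `b`, then `Γ₁ = 0`. [folklore] -/
theorem Gam1W_eq_zero_of_frozen_b (E D : Finset (Sym2 V)) (p : Sym2 V → ℝ) (K : Finset (Sym2 V)) (a b c : V)
    (hb : ∀ e ∈ D, ∀ y z : V, e = s(y, z) → y ≠ z → ¬ R K ∅ b y) :
    Gam1W E D p K a b c = 0 := by
  have eb : ∀ S, S ⊆ D → ∀ y, (R K S b y ↔ R K ∅ b y) := fun S hS y => frozen_iff hb hS y
  unfold Gam1W
  by_cases Pab : R K ∅ b a
  · -- `a` glued to `b`: `q = n′ = u₂ = u₃ = 0`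
    have hab : ∀ S, S ⊆ D → R K S a b := fun S hS => ((eb S hS a).2 Pab).symm
    rw [PrW_eq_zero_of_forall D p (fun S hS (h : S ∈ evQ K a b c) => h.1 (hab S hS)),
      PrW_eq_zero_of_forall D p (fun S hS (h : S ∈ evNp E K a b c) => h.1.1 (hab S hS)),
      PrW_eq_zero_of_forall D p (fun S hS (h : S ∈ evU₂ K a b c) => h.2 (hab S hS)),
      PrW_eq_zero_of_forall D p (fun S hS (h : S ∈ evU₃ K a b c) => h.2 (hab S hS))]
    simp only [Gam1R]; ring
  · by_cases Pbc : R K ∅ b c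
    · -- `c` glued to `b`, `a` not: everything is `bc|a` or `abc`
      have hbc : ∀ S, S ⊆ D → R K S b c := fun S hS => (eb S hS c).2 Pbc
      have hab : ∀ S, S ⊆ D → ¬ R K S a b := fun S hS h => Pab ((eb S hS a).1 h.symm)
      have hac : ∀ S, S ⊆ D → ¬ R K S a c := fun S hS h => hab S hS (h.trans (hbc S hS).symm)
      rw [PrW_eq_zero_of_forall D p (fun S hS (h : S ∈ evQ K a b c) => h.2.2 (hbc S hS)),
        PrW_eq_zero_of_forall D p (fun S hS (h : S ∈ evNp E K a b c) => h.1.2.2 (hbc S hS)),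
        PrW_eq_zero_of_forall D p (fun S hS (h : S ∈ evU₁ K a b c) => hab S hS h.1),
        PrW_eq_zero_of_forall D p (fun S hS (h : S ∈ evU₂ K a b c) => hac S hS h.1)]
      simp only [Gam1R]; ring
    · -- `b` isolated: `u₁ = u₃ = t = 0`
      have hab : ∀ S, S ⊆ D → ¬ R K S a b := fun S hS h => Pab ((eb S hS a).1 h.symm)
      have hbc : ∀ S, S ⊆ D → ¬ R K S b c := fun S hS h => Pbc ((eb S hS c).1 h)
      rw [PrW_eq_zero_of_forall D p (fun S hS (h : S ∈ evU₁ K a b c) => hab S hS h.1),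
        PrW_eq_zero_of_forall D p (fun S hS (h : S ∈ evU₃ K a b c) => hbc S hS h.1),
        PrW_eq_zero_of_forall D p (fun S hS (h : S ∈ evT K a b c) => hab S hS h.1)]
      simp only [Gam1R]; ring

/-! ### The step at `b` and the induction -/

section Induction

variable {p : Sym2 V → ℝ} (hp0 : ∀ i, 0 ≤ p i) (hp1 : ∀ i, p i ≤ 1)
include hp0 hp1

/-- **The step at `b` for `Γ₁` (unconditional).**  If `e = {x,m} ∈ D`, `x` is forced-joined to `b`, and `Γ₁ ≥ 0` for the minors
`(D ∖ e, K)` and `(D ∖ e, K ∪ {e})`, then `Γ₁ ≥ 0` for `(D, K)` (support `D ∪ K`). [folklore] -/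
theorem step_b1 {D K : Finset (Sym2 V)} {a b c x m : V}
    (hbx : ∀ S : Finset (Sym2 V), R K S b x) (he : s(x, m) ∈ D)
    (ih0 : 0 ≤ Gam1W (D.erase s(x, m) ∪ K) (D.erase s(x, m)) p K a b c)
    (ih1 : 0 ≤ Gam1W (D.erase s(x, m) ∪ insert s(x, m) K) (D.erase s(x, m)) p (insert s(x, m) K) a b c) :
    0 ≤ Gam1W (D ∪ K) D p K a b c := by
  set e := s(x, m) with he_def
  set D' := D.erase e with hD'
  set K' := insert e K with hK'
  have heD' : e ∉ D' := Finset.notMem_erase e D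
  have hD : D = insert e D' := (Finset.insert_erase he).symm
  set E := D ∪ K with hE_def
  have hE : E = insert e (D' ∪ K) := by rw [hE_def, hD, Finset.insert_union]
  have hE1 : D' ∪ K' = E := by rw [hE, hK', Finset.union_insert]
  have hsub : D' ∪ K ⊆ E := by rw [hE]; exact Finset.subset_insert _ _
  have hEall : ∀ S, S ⊆ D' → ∀ f, f ∈ S ∪ K' → f ∈ E := by
    intro S hS f hf
    rw [← hE1]
    rcases Finset.mem_union.1 hf with h | h
    · exact Finset.mem_union.2 (Or.inl (hS h))
    · exact Finset.mem_union.2 (Or.inr h)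
  -- the six masses of `(D, K)` as convex combinations of the two sections
  have sQ : PrW D p (evQ K a b c) = (1 - p e) * PrW D' p (evQ K a b c) + p e * PrW D' p (evQ K' a b c) := by
    rw [hD, PrW_split D' p heD', sect_evQ]
  have sNp : PrW D p (evNp E K a b c) = (1 - p e) * PrW D' p (evNp E K a b c) + p e * PrW D' p (evNp E K' a b c) := by
    rw [hD, PrW_split D' p heD', sect_evNp]
  have s1 : PrW D p (evU₁ K a b c) = (1 - p e) * PrW D' p (evU₁ K a b c) + p e * PrW D' p (evU₁ K' a b c) := by
    rw [hD, PrW_split D' p heD', sect_evU₁]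
  have s2 : PrW D p (evU₂ K a b c) = (1 - p e) * PrW D' p (evU₂ K a b c) + p e * PrW D' p (evU₂ K' a b c) := by
    rw [hD, PrW_split D' p heD', sect_evU₂]
  have s3 : PrW D p (evU₃ K a b c) = (1 - p e) * PrW D' p (evU₃ K a b c) + p e * PrW D' p (evU₃ K' a b c) := by
    rw [hD, PrW_split D' p heD', sect_evU₃]
  have sT : PrW D p (evT K a b c) = (1 - p e) * PrW D' p (evT K a b c) + p e * PrW D' p (evT K' a b c) := by
    rw [hD, PrW_split D' p heD', sect_evT]
  -- the coarse transitions (…CubicThreePointTransitions read with `a ↔ b`) and the `N′`-transition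
  have tQ := trans_Q D' p (a := b) (b := a) (c := c) (m := m) hbx
  rw [evQ_swap12 K a b c, evQ_swap12 K' a b c, evU₁_swap12 K' a b c, evU₂_swap12 K' a b c] at tQ
  have tA := trans_U₁ D' p (K := K) (a := b) (b := a) (c := c) (x := x) (m := m)
  rw [evU₁_swap12 K a b c, evU₁_swap12 K' a b c, evQ_swap12 K a b c, evT_swap12 K' a b c] at tA
  have tC := trans_U₂ D' p (K := K) (a := b) (b := a) (c := c) (x := x) (m := m)
  rw [evU₂_swap12 K a b c, evU₂_swap12 K' a b c, evQ_swap12 K a b c, evT_swap12 K' a b c] at tC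
  have tB := trans_U₃ D' p (a := b) (b := a) (c := c) (m := m) hbx
  rw [evU₃_swap12 K a b c, evU₃_swap12 K' a b c, evT_swap12 K' a b c] at tB
  have tT := trans_T D' p (a := b) (b := a) (c := c) (m := m) hbx
  rw [evT_swap12 K a b c, evT_swap12 K' a b c, evU₁_swap12 K a b c, evU₂_swap12 K a b c, evU₃_swap12 K a b c] at tT
  have tN := trans_Np (E := E) (a := a) (c := c) hbx D' p hEall
  have hβ : PrW D' p (evNp E K a b c ∩ evU₁ K' a b c) ≤ PrW D' p (evQ K a b c ∩ evU₁ K' a b c) :=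
    PrW_mono D' hp0 hp1 fun S _ hS => ⟨hS.1.1, hS.2⟩
  -- the three ingredients of the chord inequality
  have h0 : 0 ≤ Gam1W E D' p K a b c := le_trans ih0 (Gam1W_mono_support D' hp0 hp1 hsub K a b c)
  have h1 : 0 ≤ Gam1W E D' p K' a b c := by rw [← hE1]; exact ih1
  unfold Gam1W at h0 h1 ⊢
  rw [sQ, sNp, s1, s2, s3, sT]
  exact Gam1R_step (hp0 e) (hp1 e) tQ tA tB tC tT tN (PrW_nonneg D' hp0 hp1 _) (PrW_nonneg D' hp0 hp1 _)
    (PrW_nonneg D' hp0 hp1 _) (PrW_nonneg D' hp0 hp1 _) (PrW_nonneg D' hp0 hp1 _) (PrW_nonneg D' hp0 hp1 _) hβ h0 h1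

/-- **`Γ₁ ≥ 0` for every finite weighted graph** (strong induction on the number of random edges: while some non-loop random edge touches
the forced cluster of `b`, peel it with `step_b1`; otherwise `Γ₁ = 0`). [folklore] -/
theorem gam1W_nonneg :
    ∀ (n : ℕ) (D K : Finset (Sym2 V)) (a b c : V), D.card = n → 0 ≤ Gam1W (D ∪ K) D p K a b c := by
  intro n
  induction n using Nat.strong_induction_on with
  | _ n ih =>
  intro D K a b c hDn
  by_cases hex : ∃ e ∈ D, ∃ y z : V, e = s(y, z) ∧ y ≠ z ∧ R K ∅ b y
  · obtain ⟨e, heD, y, z, rfl, -, hreach⟩ := hex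
    have hlt : (D.erase s(y, z)).card < n := by rw [← hDn]; exact Finset.card_erase_lt_of_mem heD
    have IH : ∀ (K' : Finset (Sym2 V)), 0 ≤ Gam1W (D.erase s(y, z) ∪ K') (D.erase s(y, z)) p K' a b c :=
      fun K' => ih _ hlt _ K' a b c rfl
    exact step_b1 hp0 hp1 (fun S => R_mono_config (Finset.empty_subset S) hreach) heD (IH _) (IH _)
  · push Not at hex
    have hb : ∀ e ∈ D, ∀ y z : V, e = s(y, z) → y ≠ z → ¬ R K ∅ b y :=
      fun e he y z hyz hne => hex e he y z hyz hne
    rw [Gam1W_eq_zero_of_frozen_b (D ∪ K) D p K a b c hb]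

/-- **THEOREM (`Γ₁ ≥ 0`, unconditional).**  On every finite weighted graph (random edges `D`, weights `p ∈ [0,1]`, forced edges `K`) and for
all terminals `a, b, c`:  `P(bc|a) · P(a|b|c ∧ V(C_a) separates b from c in the support D ∪ K) ≤ AG = P(a|b|c)P(abc) − [P(ab|c)P(ac|b) +
P(ab|c)P(bc|a) + P(ac|b)P(bc|a)]` — Gladkov's `AG ≥ 0` sharpened by its exact star defect. [this work; method: Gladkov2024StrongFKG, Thm. 2.1] -/
theorem gammaOne_nonneg (D K : Finset (Sym2 V)) (a b c : V) :
    PrW D p (evU₃ K a b c) * PrW D p (evNp (D ∪ K) K a b c) ≤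
      AG (PrW D p (evQ K a b c)) (PrW D p (evU₁ K a b c)) (PrW D p (evU₂ K a b c)) (PrW D p (evU₃ K a b c))
        (PrW D p (evT K a b c)) := by
  have h := gam1W_nonneg hp0 hp1 D.card D K a b c rfl
  rw [Gam1W, Gam1R_eq_AG] at h
  linarith

/-- `Γ₁ ≥ 0` in the cell form `q·t − u₁u₂ − u₃(u₁ + u₂ + n′) ≥ 0`. [this work] -/
theorem gammaOne_nonneg' (D K : Finset (Sym2 V)) (a b c : V) :
    0 ≤ PrW D p (evQ K a b c) * PrW D p (evT K a b c) - PrW D p (evU₁ K a b c) * PrW D p (evU₂ K a b c) -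
      PrW D p (evU₃ K a b c) * (PrW D p (evU₁ K a b c) + PrW D p (evU₂ K a b c) + PrW D p (evNp (D ∪ K) K a b c)) := by
  have h := gam1W_nonneg hp0 hp1 D.card D K a b c rfl
  simpa only [Gam1W, Gam1R] using h

end Induction

end CubicThreePointApex

end Summit.CriticalPhenomena.PercolationContinuityZ3.Theorems
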